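import Summits.QuantumFields.YangMills.Theorems.UnitScaleTiltProp7OneFormGarding
import HarnessLib

/-!
# Route `UnitScaleTilt`, crux K1 «MinimiserStabilityRegPr» (stmt-QuantumFields-19200), EX rows `h137kπ` ∕ `h137kΔ` ∕ `hCk` — **K-STOREY BRICK (K2b-δ₃)-A (px12 g17, LOCATE-K137 529f36ee road
# (K2)): THE CONJUGATED RESOLVENT IS CLOSE TO THE RESOLVENT, ABSTRACT GÅRDING EDITION** — in the framework of A1 ✓`Prop7OneFormGarding.agmon_bound_of_garding` (`T = D†D + V`, a symmetric
# weight pair `M`, `M_i`, gradient conjugation defects `K₁`, `K₁′` of size `δ₁`, coercivity `γ`, `V ≥ −C_V` in form, the DIAGONAL conjugation defect `θ_V` of `V`) plus ONE new letter, the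
# BILINEAR conjugation defect of `V` (`|re(⟪Mx, V(M_iy)⟫ − ⟪x, Vy⟫)| ≤ θ₂‖x‖‖y‖`), the error `e := M(G(M_if)) − Gf` of the conjugated resolvent solves `Te = Ty − f` with `y := M(G(M_if))`,
# and testing with `e`: **`‖M(G(M_i f)) − G f‖ ≤ δ₃·‖f‖`**, `δ₃ = γ^{−1∕2}·(δ₁·√(1 + C_V∕γ)·Θ⁻¹ + δ₁·γ^{−1∕2}·b₁ + (δ₁² + θ₂)·γ^{−1∕2}·Θ⁻¹)`, `Θ = (1−ε)γ − εC_V − δ₁²(1+1∕ε) − θ_V`,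
# `b₁ = √((Θ⁻¹ + c₁Θ⁻²)∕(1−ε))`, `c₁ = δ₁²(1+1∕ε) + C_V + θ_V` — the `hB` letter (`δ₃`) of ✓p767718 `Prop7KinvConjugateDecay.conj_accretive_of_letters`, `→ 0` with `δ₁, θ₂`.

Cell `ym3-torus` (HUMAN RULING D-0037: SU(2) YM₃ on T³ is ladder rung R3 — NOT d = 4, NOT infinite volume, NOT a mass gap, NOT Clay).  Width seat `ym3-torus-px12` gen 17.  THEOREMS ONLY
(0 `def`, 0 `sorry`, default heartbeats); `--supports stmt-QuantumFields-19200 --as helper`, count-neutral.  HONEST LABEL: abstract Hilbert-space algebra (the one-form twin of routeR-w2's site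
argument ✓`Prop7MassiveConjugateResolvent.norm_weight_massive_inverse_sub_le`: error equation, test with the error, Gårding); every analytic input is a HYPOTHESIS in A1's currency; the
member edition (the bilinear `V`-letter from A2's pieces + A3's plumbing) is the sequel (K2b-δ₃)-B∕C; nothing of (3.46)∕(3.132), `h137kπ`, `h137kΔ`, `hCk`, EX or 19200 is proved here.

WHAT IS PROVED (ns `Summit.QuantumFields.YangMills.Theorems.Prop7OneFormConjugateResolvent`, abstract `E`, `G` complex inner-product spaces).
* §1 ★★ `re_conj_comm_le` — the bilinear commutator of `T` from the framework: `|re(⟪Mx, T(M_iy)⟫ − ⟪x, Ty⟫)| ≤ δ₁‖Dx‖‖y‖ + δ₁‖x‖‖Dy‖ + (δ₁² + θ₂)‖x‖‖y‖`.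
* §2 ★★ `conj_energy_le` — the energy of a conjugated solution: `Tu = f′`, `y = Mu` ⟹ `(1−ε)‖Dy‖² ≤ re⟪y, Mf′⟫ + c₁‖y‖²` (A1's key identity + AM–GM); `normSq_D_le_of_garding` (`‖Dv‖² ≤ re⟪v,Tv⟫ + C_V‖v‖²`).
* §3 `norm_le_of_sq_le`, ★ `error_le_of_rows` (the real bookkeeping `√S ≤ R`), ★★★ `norm_conj_resolvent_sub_le` — THE THEOREM ABOVE.
HYP-SAT (★★OWNER RULING №42): every hypothesis is A1's (inhabited at the member by A3 ✓`agmon_oneForm_of_letters`' plumbing: Kato gradient ✓`exists_katoGradient`, multipliers ✓`exists_smulBond`,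
defects ✓`normSq_gradDefect_le`, (γ) ✓p767766, (C_V) A1 ✓`katoEnergy_le`∕px21 A2h, (θ_V) A2g ✓`hVconj_phaseClass_of_letters`) plus `hMMi` (the reciprocal multiplier, same package), `hTG` (`Δ_aG = 1` on
`PosOnto`, ✓`laplaceA_GT`) and the bilinear `hVconj₂` (sequel B: A2's (Q)(P)(L)(S) pieces, bilinear editions); nothing eventual; no hypothesis restates the conclusion (the conclusion is an
operator-closeness, the hypotheses are form letters).

References: S. Agmon, *Lectures on exponential decay of solutions of second-order elliptic equations* (Princeton 1982) Ch. 1 [Agmon1982]; T. Bałaban, CMP **99** (1985) 389–434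
[Balaban1985BackgroundPropagators] (Thm 3.1 (3.46) p.398, (3.100)–(3.105) pp.413–414, (3.132) p.422); J.-M. Combes, L. Thomas, CMP **34** (1973) 251–270 [folklore].
-/

set_option autoImplicit false

noncomputable section

open scoped InnerProductSpace ComplexConjugate

namespace Summit.QuantumFields.YangMills.Theorems.Prop7OneFormConjugateResolvent

open Summit.QuantumFields.YangMills.Theorems.Prop7OneFormGarding (agmon_bound_of_garding re_inner_le_norm_mul_norm' neg_norm_mul_norm_le_re_inner)

variable {E : Type*} [NormedAddCommGroup E] [InnerProductSpace ℂ E] {G : Type*} [NormedAddCommGroup G] [InnerProductSpace ℂ G]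

/-! ## §1 The bilinear commutator of `T = D†D + V` under the weight pair -/

/-- ★★ **THE BILINEAR CONJUGATION DEFECT OF `T = D†D + V`**: with the gradient defects `D(Mv) = M′(Dv + K₁v)`, `D(M_iv) = M′_i(Dv + K₁′v)` (`‖K₁v‖, ‖K₁′v‖ ≤ δ₁‖v‖`), the pairing
`⟪M′a, M′_ib⟫ = ⟪a, b⟫` and the bilinear `V`-letter `|re(⟪Mx, V(M_iy)⟫ − ⟪x, Vy⟫)| ≤ θ₂‖x‖‖y‖`:
`|re(⟪Mx, T(M_iy)⟫ − ⟪x, Ty⟫)| ≤ δ₁‖Dx‖‖y‖ + δ₁‖x‖‖Dy‖ + (δ₁² + θ₂)‖x‖‖y‖`. [cite: Balaban1985BackgroundPropagators, Thm 3.1 (3.46) p.398, (3.100)–(3.105) pp.413–414; Agmon1982, Ch. 1] -/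
theorem re_conj_comm_le
    (D : E →ₗ[ℂ] G) (Dad : G →ₗ[ℂ] E) (hDad : ∀ (v : E) (g : G), ⟪D v, g⟫_ℂ = ⟪v, Dad g⟫_ℂ)
    (T V : E →ₗ[ℂ] E) (hT : ∀ v, T v = Dad (D v) + V v)
    (M Mi : E →ₗ[ℂ] E) (M' M'i : G →ₗ[ℂ] G) (hpair : ∀ a b : G, ⟪M' a, M'i b⟫_ℂ = ⟪a, b⟫_ℂ)
    (K₁ K₁' : E →ₗ[ℂ] G) (hK₁ : ∀ v, D (M v) = M' (D v + K₁ v)) (hK₁' : ∀ v, D (Mi v) = M'i (D v + K₁' v))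
    {δ₁ θ₂ : ℝ} (hδ₁ : 0 ≤ δ₁) (bK₁ : ∀ v, ‖K₁ v‖ ≤ δ₁ * ‖v‖) (bK₁' : ∀ v, ‖K₁' v‖ ≤ δ₁ * ‖v‖)
    (hVconj₂ : ∀ x y : E, |RCLike.re (⟪M x, V (Mi y)⟫_ℂ - ⟪x, V y⟫_ℂ)| ≤ θ₂ * ‖x‖ * ‖y‖) (x y : E) :
    |RCLike.re (⟪M x, T (Mi y)⟫_ℂ - ⟪x, T y⟫_ℂ)| ≤ δ₁ * ‖D x‖ * ‖y‖ + δ₁ * ‖x‖ * ‖D y‖ + (δ₁ ^ 2 + θ₂) * ‖x‖ * ‖y‖ := by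
  -- the algebra: the Kato pairings cancel, three gradient cross terms and the `V`-defect remain
  have hid : ⟪M x, T (Mi y)⟫_ℂ - ⟪x, T y⟫_ℂ
      = (⟪D x, K₁' y⟫_ℂ + ⟪K₁ x, D y⟫_ℂ + ⟪K₁ x, K₁' y⟫_ℂ) + (⟪M x, V (Mi y)⟫_ℂ - ⟪x, V y⟫_ℂ) := by
    rw [hT (Mi y), hT y, inner_add_right, inner_add_right, ← hDad, ← hDad, hK₁ x, hK₁' y, hpair, inner_add_left, inner_add_right, inner_add_right]
    ring
  rw [hid, map_add]
  have h1 : |RCLike.re ⟪D x, K₁' y⟫_ℂ| ≤ δ₁ * ‖D x‖ * ‖y‖ := by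
    refine (RCLike.abs_re_le_norm _).trans ((norm_inner_le_norm _ _).trans ?_)
    calc ‖D x‖ * ‖K₁' y‖ ≤ ‖D x‖ * (δ₁ * ‖y‖) := mul_le_mul_of_nonneg_left (bK₁' y) (norm_nonneg _)
      _ = δ₁ * ‖D x‖ * ‖y‖ := by ring
  have h2 : |RCLike.re ⟪K₁ x, D y⟫_ℂ| ≤ δ₁ * ‖x‖ * ‖D y‖ := by
    refine (RCLike.abs_re_le_norm _).trans ((norm_inner_le_norm _ _).trans ?_)
    exact mul_le_mul_of_nonneg_right (bK₁ x) (norm_nonneg _)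
  have h3 : |RCLike.re ⟪K₁ x, K₁' y⟫_ℂ| ≤ δ₁ ^ 2 * ‖x‖ * ‖y‖ := by
    refine (RCLike.abs_re_le_norm _).trans ((norm_inner_le_norm _ _).trans ?_)
    calc ‖K₁ x‖ * ‖K₁' y‖ ≤ (δ₁ * ‖x‖) * (δ₁ * ‖y‖) := mul_le_mul (bK₁ x) (bK₁' y) (norm_nonneg _) (by positivity)
      _ = δ₁ ^ 2 * ‖x‖ * ‖y‖ := by ring
  have h4 := hVconj₂ x y
  have hs : |RCLike.re (⟪D x, K₁' y⟫_ℂ + ⟪K₁ x, D y⟫_ℂ + ⟪K₁ x, K₁' y⟫_ℂ)| ≤ δ₁ * ‖D x‖ * ‖y‖ + δ₁ * ‖x‖ * ‖D y‖ + δ₁ ^ 2 * ‖x‖ * ‖y‖ := by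
    rw [map_add, map_add]
    have hab : |RCLike.re ⟪D x, K₁' y⟫_ℂ + RCLike.re ⟪K₁ x, D y⟫_ℂ| ≤ δ₁ * ‖D x‖ * ‖y‖ + δ₁ * ‖x‖ * ‖D y‖ := (abs_add_le _ _).trans (add_le_add h1 h2)
    exact (abs_add_le _ _).trans (add_le_add hab h3)
  calc |RCLike.re (⟪D x, K₁' y⟫_ℂ + ⟪K₁ x, D y⟫_ℂ + ⟪K₁ x, K₁' y⟫_ℂ) + RCLike.re (⟪M x, V (Mi y)⟫_ℂ - ⟪x, V y⟫_ℂ)|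
      ≤ |RCLike.re (⟪D x, K₁' y⟫_ℂ + ⟪K₁ x, D y⟫_ℂ + ⟪K₁ x, K₁' y⟫_ℂ)| + |RCLike.re (⟪M x, V (Mi y)⟫_ℂ - ⟪x, V y⟫_ℂ)| := abs_add_le _ _
    _ ≤ (δ₁ * ‖D x‖ * ‖y‖ + δ₁ * ‖x‖ * ‖D y‖ + δ₁ ^ 2 * ‖x‖ * ‖y‖) + θ₂ * ‖x‖ * ‖y‖ := add_le_add hs h4
    _ = δ₁ * ‖D x‖ * ‖y‖ + δ₁ * ‖x‖ * ‖D y‖ + (δ₁ ^ 2 + θ₂) * ‖x‖ * ‖y‖ := by ring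

/-! ## §2 The energy of a conjugated solution, and Gårding for the error -/

/-- ★★ **THE ENERGY OF A CONJUGATED SOLUTION**: for `Tu = f′` and `y := Mu`, A1's key identity `⟪y, Mf′⟫ = ⟪Dy + K₁y, Dy + K₁′y⟫ + ⟪My, V(M_iy)⟫` and AM–GM give
`(1−ε)·‖Dy‖² ≤ re⟪y, Mf′⟫ + (δ₁²(1+1∕ε) + C_V + θ_V)·‖y‖²` (`0 < ε ≤ 1`). [cite: Balaban1985BackgroundPropagators, Thm 3.1 (3.46) p.398; Agmon1982, Ch. 1] -/
theorem conj_energy_le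
    (D : E →ₗ[ℂ] G) (Dad : G →ₗ[ℂ] E) (hDad : ∀ (v : E) (g : G), ⟪D v, g⟫_ℂ = ⟪v, Dad g⟫_ℂ)
    (T V : E →ₗ[ℂ] E) (hT : ∀ v, T v = Dad (D v) + V v)
    (M Mi : E →ₗ[ℂ] E) (M' M'i : G →ₗ[ℂ] G) (hMiM : ∀ v, Mi (M v) = v)
    (hMsa : ∀ x y : E, ⟪M x, y⟫_ℂ = ⟪x, M y⟫_ℂ) (hpair : ∀ a b : G, ⟪M' a, M'i b⟫_ℂ = ⟪a, b⟫_ℂ)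
    (K₁ K₁' : E →ₗ[ℂ] G) (hK₁ : ∀ v, D (M v) = M' (D v + K₁ v)) (hK₁' : ∀ v, D (Mi v) = M'i (D v + K₁' v))
    {CV δ₁ θV ε : ℝ} (hδ₁ : 0 ≤ δ₁) (hε : 0 < ε)
    (hVlow : ∀ v, -(CV * ‖v‖ ^ 2) ≤ RCLike.re ⟪v, V v⟫_ℂ)
    (bK₁ : ∀ v, ‖K₁ v‖ ≤ δ₁ * ‖v‖) (bK₁' : ∀ v, ‖K₁' v‖ ≤ δ₁ * ‖v‖)
    (hVconj : ∀ v, RCLike.re ⟪v, V v⟫_ℂ - θV * ‖v‖ ^ 2 ≤ RCLike.re ⟪M v, V (Mi v)⟫_ℂ)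
    (u f' : E) (hu : T u = f') :
    (1 - ε) * ‖D (M u)‖ ^ 2 ≤ RCLike.re ⟪M u, M f'⟫_ℂ + (δ₁ ^ 2 * (1 + 1 / ε) + CV + θV) * ‖M u‖ ^ 2 := by
  set w : E := M u with hw
  have huw : u = Mi w := by rw [hw, hMiM]
  have key : ⟪w, M f'⟫_ℂ = ⟪D w + K₁ w, D w + K₁' w⟫_ℂ + ⟪M w, V (Mi w)⟫_ℂ := by
    rw [← hMsa, ← hu, hT, inner_add_right, ← hDad, hK₁ w, huw, hK₁' w, hpair, ← huw]
  have hre : RCLike.re ⟪D w + K₁ w, D w + K₁' w⟫_ℂ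
      = ‖D w‖ ^ 2 + RCLike.re ⟪D w, K₁' w⟫_ℂ + RCLike.re ⟪K₁ w, D w⟫_ℂ + RCLike.re ⟪K₁ w, K₁' w⟫_ℂ := by
    rw [inner_add_left, inner_add_right, inner_add_right, map_add, map_add, map_add, inner_self_eq_norm_sq]; ring
  have h1 : -(‖D w‖ * (δ₁ * ‖w‖)) ≤ RCLike.re ⟪D w, K₁' w⟫_ℂ :=
    (neg_le_neg (mul_le_mul_of_nonneg_left (bK₁' w) (norm_nonneg _))).trans (neg_norm_mul_norm_le_re_inner _ _)
  have h2 : -(δ₁ * ‖w‖ * ‖D w‖) ≤ RCLike.re ⟪K₁ w, D w⟫_ℂ :=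
    (neg_le_neg (mul_le_mul_of_nonneg_right (bK₁ w) (norm_nonneg _))).trans (neg_norm_mul_norm_le_re_inner _ _)
  have h3 : -(δ₁ * ‖w‖ * (δ₁ * ‖w‖)) ≤ RCLike.re ⟪K₁ w, K₁' w⟫_ℂ :=
    (neg_le_neg (mul_le_mul (bK₁ w) (bK₁' w) (norm_nonneg _) (by positivity))).trans (neg_norm_mul_norm_le_re_inner _ _)
  have hamgm : 2 * (δ₁ * ‖w‖ * ‖D w‖) ≤ ε * ‖D w‖ ^ 2 + δ₁ ^ 2 / ε * ‖w‖ ^ 2 := by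
    have e2 : ε * ‖D w‖ ^ 2 + δ₁ ^ 2 / ε * ‖w‖ ^ 2 - 2 * (δ₁ * ‖w‖ * ‖D w‖) = (ε * ‖D w‖ - δ₁ * ‖w‖) ^ 2 / ε := by
      field_simp
      ring
    rw [← sub_nonneg, e2]
    positivity
  have hv := hVlow w
  have hcj := hVconj w
  rw [key, map_add, hre]
  have e1 : (δ₁ ^ 2 * (1 + 1 / ε) + CV + θV) * ‖w‖ ^ 2 = δ₁ * ‖w‖ * (δ₁ * ‖w‖) + δ₁ ^ 2 / ε * ‖w‖ ^ 2 + CV * ‖w‖ ^ 2 + θV * ‖w‖ ^ 2 := by ring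
  have e2 : ‖D w‖ * (δ₁ * ‖w‖) = δ₁ * ‖w‖ * ‖D w‖ := by ring
  linarith [h1, h2, h3, hamgm, e1, e2, hv, hcj]

/-- **GÅRDING FOR `T = D†D + V`**: `‖Dv‖² ≤ re⟪v, Tv⟫ + C_V‖v‖²`. [cite: Balaban1985Variational, (134)–(136) p.298] -/
theorem normSq_D_le_of_garding
    (D : E →ₗ[ℂ] G) (Dad : G →ₗ[ℂ] E) (hDad : ∀ (v : E) (g : G), ⟪D v, g⟫_ℂ = ⟪v, Dad g⟫_ℂ)
    (T V : E →ₗ[ℂ] E) (hT : ∀ v, T v = Dad (D v) + V v) {CV : ℝ}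
    (hVlow : ∀ v, -(CV * ‖v‖ ^ 2) ≤ RCLike.re ⟪v, V v⟫_ℂ) (v : E) :
    ‖D v‖ ^ 2 ≤ RCLike.re ⟪v, T v⟫_ℂ + CV * ‖v‖ ^ 2 := by
  have hTw : RCLike.re ⟪v, T v⟫_ℂ = ‖D v‖ ^ 2 + RCLike.re ⟪v, V v⟫_ℂ := by
    rw [hT, inner_add_right, map_add, ← hDad, inner_self_eq_norm_sq]
  have := hVlow v
  linarith

/-! ## §3 ★★★ The conjugated resolvent is close to the resolvent -/

omit [InnerProductSpace ℂ E] in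
/-- `‖x‖² ≤ t²`, `0 ≤ t` ⟹ `‖x‖ ≤ t`. [folklore] -/
theorem norm_le_of_sq_le {x : E} {t : ℝ} (ht : 0 ≤ t) (h : ‖x‖ ^ 2 ≤ t ^ 2) : ‖x‖ ≤ t :=
  (pow_le_pow_iff_left₀ (norm_nonneg _) ht two_ne_zero).mp h

/-- ★ **THE REAL BOOKKEEPING OF THE ERROR BOUND**: if `γ·n_e² ≤ S`, `n_{De}² ≤ S·(1 + C_V∕γ)` and `S ≤ δ₁·n_{De}·n_y + δ₁·n_e·n_{Dy} + (δ₁² + θ₂)·n_e·n_y` (all quantities `≥ 0`, `γ > 0`),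
then `n_e ≤ γ^{−1∕2}·(δ₁√(1 + C_V∕γ)·n_y + δ₁γ^{−1∕2}·n_{Dy} + (δ₁² + θ₂)γ^{−1∕2}·n_y)` (`√S ≤ R` from `S ≤ √S·R`). [folklore] -/
theorem error_le_of_rows {γ CV δ₁ θ₂ S ne nDe ny nDy : ℝ} (hγ : 0 < γ) (hCV : 0 ≤ CV) (hδ₁ : 0 ≤ δ₁) (hθ₂ : 0 ≤ θ₂)
    (hne : 0 ≤ ne) (hnDe : 0 ≤ nDe) (hny : 0 ≤ ny) (hnDy : 0 ≤ nDy)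
    (hSe : γ * ne ^ 2 ≤ S) (hDe : nDe ^ 2 ≤ S * (1 + CV / γ)) (hS : S ≤ δ₁ * nDe * ny + δ₁ * ne * nDy + (δ₁ ^ 2 + θ₂) * ne * ny) :
    ne ≤ (Real.sqrt γ)⁻¹ * (δ₁ * Real.sqrt (1 + CV / γ) * ny + δ₁ * (Real.sqrt γ)⁻¹ * nDy + (δ₁ ^ 2 + θ₂) * (Real.sqrt γ)⁻¹ * ny) := by
  have hS0 : 0 ≤ S := le_trans (by positivity) hSe
  set s : ℝ := Real.sqrt S with hs
  have hs0 : 0 ≤ s := Real.sqrt_nonneg _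
  have hs2 : s ^ 2 = S := Real.sq_sqrt hS0
  have hγs : 0 < Real.sqrt γ := Real.sqrt_pos.mpr hγ
  have he_le : ne ≤ s * (Real.sqrt γ)⁻¹ := by
    refine (pow_le_pow_iff_left₀ hne (by positivity) two_ne_zero).mp ?_
    rw [mul_pow, hs2, inv_pow, Real.sq_sqrt hγ.le, ← div_eq_mul_inv, le_div_iff₀ hγ]
    linarith only [hSe]
  have hDe_le : nDe ≤ s * Real.sqrt (1 + CV / γ) := by
    refine (pow_le_pow_iff_left₀ hnDe (by positivity) two_ne_zero).mp ?_
    rw [mul_pow, hs2, Real.sq_sqrt (by positivity)]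
    exact hDe
  set R : ℝ := δ₁ * Real.sqrt (1 + CV / γ) * ny + δ₁ * (Real.sqrt γ)⁻¹ * nDy + (δ₁ ^ 2 + θ₂) * (Real.sqrt γ)⁻¹ * ny with hR
  have hR0 : 0 ≤ R := by positivity
  have hsR : s ^ 2 ≤ s * R := by
    have t1 : δ₁ * nDe * ny ≤ δ₁ * (s * Real.sqrt (1 + CV / γ)) * ny :=
      mul_le_mul_of_nonneg_right (mul_le_mul_of_nonneg_left hDe_le hδ₁) hny
    have t2 : δ₁ * ne * nDy ≤ δ₁ * (s * (Real.sqrt γ)⁻¹) * nDy :=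
      mul_le_mul_of_nonneg_right (mul_le_mul_of_nonneg_left he_le hδ₁) hnDy
    have t3 : (δ₁ ^ 2 + θ₂) * ne * ny ≤ (δ₁ ^ 2 + θ₂) * (s * (Real.sqrt γ)⁻¹) * ny :=
      mul_le_mul_of_nonneg_right (mul_le_mul_of_nonneg_left he_le (by positivity)) hny
    calc s ^ 2 = S := hs2
      _ ≤ δ₁ * nDe * ny + δ₁ * ne * nDy + (δ₁ ^ 2 + θ₂) * ne * ny := hS
      _ ≤ δ₁ * (s * Real.sqrt (1 + CV / γ)) * ny + δ₁ * (s * (Real.sqrt γ)⁻¹) * nDy + (δ₁ ^ 2 + θ₂) * (s * (Real.sqrt γ)⁻¹) * ny :=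
          add_le_add (add_le_add t1 t2) t3
      _ = s * R := by rw [hR]; ring
  have hs_le : s ≤ R := by
    by_cases h0 : s = 0
    · rw [h0]; exact hR0
    · have hpos : 0 < s := lt_of_le_of_ne hs0 (Ne.symm h0)
      have h' : s * s ≤ R * s := by rw [← sq, mul_comm R s]; exact hsR
      exact le_of_mul_le_mul_right h' hpos
  calc ne ≤ s * (Real.sqrt γ)⁻¹ := he_le
    _ ≤ R * (Real.sqrt γ)⁻¹ := mul_le_mul_of_nonneg_right hs_le (by positivity)
    _ = (Real.sqrt γ)⁻¹ * R := mul_comm _ _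

/-- ★★★ **THE CONJUGATED RESOLVENT IS CLOSE TO THE RESOLVENT** (the `δ₃` letter `hB` of ✓`Prop7KinvConjugateDecay.conj_accretive_of_letters`).  In A1's framework (`T = D†D + V`, symmetric
weight `M` with two-sided inverse `M_i`, `⟪M′a, M′_ib⟫ = ⟪a, b⟫`, gradient defects `K₁`, `K₁′` of size `δ₁`, coercivity `γ > 0`, `V ≥ −C_V` (`C_V ≥ 0`), diagonal defect `θ_V ≥ 0`) with the
BILINEAR `V`-letter `θ₂ ≥ 0`, a right inverse `G` of `T` (`T(Gf) = f`), `0 < ε < 1` and `Θ := (1−ε)γ − εC_V − δ₁²(1+1∕ε) − θ_V > 0`: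
**`‖M(G(M_i f)) − G f‖ ≤ γ^{−1∕2}·(δ₁·√(1 + C_V∕γ)·Θ⁻¹ + δ₁·γ^{−1∕2}·√((Θ⁻¹ + c₁Θ⁻²)∕(1−ε)) + (δ₁² + θ₂)·γ^{−1∕2}·Θ⁻¹)·‖f‖`**, `c₁ = δ₁²(1+1∕ε) + C_V + θ_V` — every term carries `δ₁` or `θ₂`
(the weight's slope), so `δ₃ → 0` with the Agmon rate. [cite: Balaban1985BackgroundPropagators, Thm 3.1 (3.46) p.398, (3.132) p.422; Agmon1982, Ch. 1] -/
theorem norm_conj_resolvent_sub_le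
    (D : E →ₗ[ℂ] G) (Dad : G →ₗ[ℂ] E) (hDad : ∀ (v : E) (g : G), ⟪D v, g⟫_ℂ = ⟪v, Dad g⟫_ℂ)
    (T V : E →ₗ[ℂ] E) (hT : ∀ v, T v = Dad (D v) + V v)
    (M Mi : E →ₗ[ℂ] E) (M' M'i : G →ₗ[ℂ] G) (hMiM : ∀ v, Mi (M v) = v) (hMMi : ∀ v, M (Mi v) = v)
    (hMsa : ∀ x y : E, ⟪M x, y⟫_ℂ = ⟪x, M y⟫_ℂ) (hpair : ∀ a b : G, ⟪M' a, M'i b⟫_ℂ = ⟪a, b⟫_ℂ)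
    (K₁ K₁' : E →ₗ[ℂ] G) (hK₁ : ∀ v, D (M v) = M' (D v + K₁ v)) (hK₁' : ∀ v, D (Mi v) = M'i (D v + K₁' v))
    {γ CV δ₁ θV θ₂ ε : ℝ} (hγ : 0 < γ) (hCV : 0 ≤ CV) (hδ₁ : 0 ≤ δ₁) (hθV : 0 ≤ θV) (hθ₂ : 0 ≤ θ₂) (hε : 0 < ε) (hε1 : ε < 1)
    (hΘ : 0 < (1 - ε) * γ - ε * CV - δ₁ ^ 2 * (1 + 1 / ε) - θV)
    (hco : ∀ v, γ * ‖v‖ ^ 2 ≤ RCLike.re ⟪v, T v⟫_ℂ)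
    (hVlow : ∀ v, -(CV * ‖v‖ ^ 2) ≤ RCLike.re ⟪v, V v⟫_ℂ)
    (bK₁ : ∀ v, ‖K₁ v‖ ≤ δ₁ * ‖v‖) (bK₁' : ∀ v, ‖K₁' v‖ ≤ δ₁ * ‖v‖)
    (hVconj : ∀ v, RCLike.re ⟪v, V v⟫_ℂ - θV * ‖v‖ ^ 2 ≤ RCLike.re ⟪M v, V (Mi v)⟫_ℂ)
    (hVconj₂ : ∀ x y : E, |RCLike.re (⟪M x, V (Mi y)⟫_ℂ - ⟪x, V y⟫_ℂ)| ≤ θ₂ * ‖x‖ * ‖y‖)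
    (Gop : E →ₗ[ℂ] E) (hTG : ∀ f, T (Gop f) = f) (f : E) :
    ‖M (Gop (Mi f)) - Gop f‖
      ≤ (Real.sqrt γ)⁻¹ * (δ₁ * Real.sqrt (1 + CV / γ) * ((1 - ε) * γ - ε * CV - δ₁ ^ 2 * (1 + 1 / ε) - θV)⁻¹
          + δ₁ * (Real.sqrt γ)⁻¹ * Real.sqrt ((((1 - ε) * γ - ε * CV - δ₁ ^ 2 * (1 + 1 / ε) - θV)⁻¹
              + (δ₁ ^ 2 * (1 + 1 / ε) + CV + θV) * ((1 - ε) * γ - ε * CV - δ₁ ^ 2 * (1 + 1 / ε) - θV)⁻¹ ^ 2) / (1 - ε))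
          + (δ₁ ^ 2 + θ₂) * (Real.sqrt γ)⁻¹ * ((1 - ε) * γ - ε * CV - δ₁ ^ 2 * (1 + 1 / ε) - θV)⁻¹) * ‖f‖ := by
  -- names
  set Θ : ℝ := (1 - ε) * γ - ε * CV - δ₁ ^ 2 * (1 + 1 / ε) - θV with hΘdef
  set c₁ : ℝ := δ₁ ^ 2 * (1 + 1 / ε) + CV + θV with hc₁
  have hc₁0 : 0 ≤ c₁ := by positivity
  have hΘi : 0 < Θ⁻¹ := inv_pos.mpr hΘ
  have h1ε : 0 < 1 - ε := by linarith only [hε1]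
  set g : E := Gop (Mi f) with hg
  have hTg : T g = Mi f := hTG _
  set y : E := M g with hy
  have hgy : g = Mi y := by rw [hy, hMiM]
  set e : E := y - Gop f with he
  -- (i) the conjugated solution is `L²`-bounded: `Θ‖y‖ ≤ ‖f‖` (A1)
  have hA1 := agmon_bound_of_garding D Dad hDad T V hT M Mi M' M'i hMiM hMsa hpair K₁ K₁' hK₁ hK₁' hδ₁ hε hε1.le hco hVlow bK₁ bK₁' hVconj g (Mi f) hTg
  rw [hMMi] at hA1
  have hyle : ‖y‖ ≤ Θ⁻¹ * ‖f‖ := by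
    rw [le_inv_mul_iff₀ hΘ]; exact hA1
  -- (ii) its energy: `(1−ε)‖Dy‖² ≤ re⟪y, f⟫ + c₁‖y‖² ≤ (Θ⁻¹ + c₁Θ⁻²)‖f‖²`
  have hEy := conj_energy_le D Dad hDad T V hT M Mi M' M'i hMiM hMsa hpair K₁ K₁' hK₁ hK₁' hδ₁ hε hVlow bK₁ bK₁' hVconj g (Mi f) hTg
  rw [hMMi] at hEy
  have hDy_sq : ‖D y‖ ^ 2 ≤ (Θ⁻¹ + c₁ * Θ⁻¹ ^ 2) / (1 - ε) * ‖f‖ ^ 2 := by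
    rw [div_mul_eq_mul_div, le_div_iff₀ h1ε]
    have hre : RCLike.re ⟪y, f⟫_ℂ ≤ ‖y‖ * ‖f‖ := re_inner_le_norm_mul_norm' _ _
    have hyf : ‖y‖ * ‖f‖ ≤ Θ⁻¹ * ‖f‖ * ‖f‖ := mul_le_mul_of_nonneg_right hyle (norm_nonneg _)
    have hy2 : ‖y‖ ^ 2 ≤ (Θ⁻¹ * ‖f‖) ^ 2 := pow_le_pow_left₀ (norm_nonneg _) hyle 2
    have hEy' : (1 - ε) * ‖D y‖ ^ 2 ≤ RCLike.re ⟪y, f⟫_ℂ + c₁ * ‖y‖ ^ 2 := hEy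
    calc ‖D y‖ ^ 2 * (1 - ε) = (1 - ε) * ‖D y‖ ^ 2 := mul_comm _ _
      _ ≤ RCLike.re ⟪y, f⟫_ℂ + c₁ * ‖y‖ ^ 2 := hEy'
      _ ≤ Θ⁻¹ * ‖f‖ * ‖f‖ + c₁ * (Θ⁻¹ * ‖f‖) ^ 2 := add_le_add (hre.trans hyf) (mul_le_mul_of_nonneg_left hy2 hc₁0)
      _ = (Θ⁻¹ + c₁ * Θ⁻¹ ^ 2) * ‖f‖ ^ 2 := by ring
  set b₁ : ℝ := Real.sqrt ((Θ⁻¹ + c₁ * Θ⁻¹ ^ 2) / (1 - ε)) with hb₁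
  have hb₁0 : 0 ≤ b₁ := Real.sqrt_nonneg _
  have hDy : ‖D y‖ ≤ b₁ * ‖f‖ := by
    refine norm_le_of_sq_le (by positivity) ?_
    rw [mul_pow, hb₁, Real.sq_sqrt (by positivity)]
    exact hDy_sq
  -- (iii) the error equation tested with the error: `re⟪e, Te⟫ = −re(⟪Me, T(M_iy)⟫ − ⟪e, Ty⟫)`
  have hTe : T e = T y - f := by rw [he, map_sub, hTG]
  have hS_eq : RCLike.re ⟪e, T e⟫_ℂ = -RCLike.re (⟪M e, T (Mi y)⟫_ℂ - ⟪e, T y⟫_ℂ) := by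
    have h1 : ⟪e, f⟫_ℂ = ⟪M e, T (Mi y)⟫_ℂ := by
      rw [← hgy, hTg, hMsa, hMMi]
    have hre : ∀ a b : ℂ, RCLike.re (a - b) = RCLike.re a - RCLike.re b := fun a b => map_sub _ a b
    rw [hTe, inner_sub_right, hre, hre, h1]; ring
  have hSe : γ * ‖e‖ ^ 2 ≤ RCLike.re ⟪e, T e⟫_ℂ := hco e
  have hcomm := re_conj_comm_le D Dad hDad T V hT M Mi M' M'i hpair K₁ K₁' hK₁ hK₁' hδ₁ bK₁ bK₁' hVconj₂ e y
  have hSle : RCLike.re ⟪e, T e⟫_ℂ ≤ δ₁ * ‖D e‖ * ‖y‖ + δ₁ * ‖e‖ * ‖D y‖ + (δ₁ ^ 2 + θ₂) * ‖e‖ * ‖y‖ := by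
    rw [hS_eq]
    exact (neg_le_abs _).trans hcomm
  -- (iv) Gårding for `e`: `‖De‖² ≤ re⟪e,Te⟫·(1 + C_V∕γ)`
  have hDe : ‖D e‖ ^ 2 ≤ RCLike.re ⟪e, T e⟫_ℂ * (1 + CV / γ) := by
    have hG := normSq_D_le_of_garding D Dad hDad T V hT hVlow e
    have h2 : CV * ‖e‖ ^ 2 ≤ CV / γ * RCLike.re ⟪e, T e⟫_ℂ := by
      rw [div_mul_eq_mul_div, le_div_iff₀ hγ]
      have := mul_le_mul_of_nonneg_left hSe hCV
      linarith only [this]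
    calc ‖D e‖ ^ 2 ≤ RCLike.re ⟪e, T e⟫_ℂ + CV * ‖e‖ ^ 2 := hG
      _ ≤ RCLike.re ⟪e, T e⟫_ℂ + CV / γ * RCLike.re ⟪e, T e⟫_ℂ := by linarith only [h2]
      _ = RCLike.re ⟪e, T e⟫_ℂ * (1 + CV / γ) := by ring
  -- (v) the real bookkeeping, (vi) insert `‖y‖ ≤ Θ⁻¹‖f‖`, `‖Dy‖ ≤ b₁‖f‖`
  have herr := error_le_of_rows hγ hCV hδ₁ hθ₂ (norm_nonneg e) (norm_nonneg (D e)) (norm_nonneg y) (norm_nonneg (D y)) hSe hDe hSle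
  have hRle : δ₁ * Real.sqrt (1 + CV / γ) * ‖y‖ + δ₁ * (Real.sqrt γ)⁻¹ * ‖D y‖ + (δ₁ ^ 2 + θ₂) * (Real.sqrt γ)⁻¹ * ‖y‖
      ≤ (δ₁ * Real.sqrt (1 + CV / γ) * Θ⁻¹ + δ₁ * (Real.sqrt γ)⁻¹ * b₁ + (δ₁ ^ 2 + θ₂) * (Real.sqrt γ)⁻¹ * Θ⁻¹) * ‖f‖ := by
    have hγs : 0 < Real.sqrt γ := Real.sqrt_pos.mpr hγ
    have t1 : δ₁ * Real.sqrt (1 + CV / γ) * ‖y‖ ≤ δ₁ * Real.sqrt (1 + CV / γ) * (Θ⁻¹ * ‖f‖) := mul_le_mul_of_nonneg_left hyle (by positivity)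
    have t2 : δ₁ * (Real.sqrt γ)⁻¹ * ‖D y‖ ≤ δ₁ * (Real.sqrt γ)⁻¹ * (b₁ * ‖f‖) := mul_le_mul_of_nonneg_left hDy (by positivity)
    have t3 : (δ₁ ^ 2 + θ₂) * (Real.sqrt γ)⁻¹ * ‖y‖ ≤ (δ₁ ^ 2 + θ₂) * (Real.sqrt γ)⁻¹ * (Θ⁻¹ * ‖f‖) := mul_le_mul_of_nonneg_left hyle (by positivity)
    calc _ ≤ δ₁ * Real.sqrt (1 + CV / γ) * (Θ⁻¹ * ‖f‖) + δ₁ * (Real.sqrt γ)⁻¹ * (b₁ * ‖f‖) + (δ₁ ^ 2 + θ₂) * (Real.sqrt γ)⁻¹ * (Θ⁻¹ * ‖f‖) :=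
          add_le_add (add_le_add t1 t2) t3
      _ = _ := by ring
  have hγs : 0 < Real.sqrt γ := Real.sqrt_pos.mpr hγ
  calc ‖e‖ ≤ _ := herr
    _ ≤ (Real.sqrt γ)⁻¹ * ((δ₁ * Real.sqrt (1 + CV / γ) * Θ⁻¹ + δ₁ * (Real.sqrt γ)⁻¹ * b₁ + (δ₁ ^ 2 + θ₂) * (Real.sqrt γ)⁻¹ * Θ⁻¹) * ‖f‖) :=
        mul_le_mul_of_nonneg_left hRle (by positivity)
    _ = _ := by ring

end Summit.QuantumFields.YangMills.Theorems.Prop7OneFormConjugateResolvent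

end
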